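import Literature.AnabelianGeometry.SemiGraphs.PSCCoveringMapAlong
import Literature.AnabelianGeometry.SemiGraphs.PSCCompactificationTransfer
import HarnessLib

/-!
# [CombGC] Thm. 1.6 "we may assume `Σ = {l}`": the hypotheses on `α` survive the passage to the image data

Mochizuki, *A combinatorial version of the Grothendieck conjecture*, Tohoku Math. J. **59** (2007),
proof of Thm. 1.6 (i), author's ms p. 13 l.−8…−4 ("we may assume that `Σ = {l}`"), Def. 1.4
pp. 10–11 [cite: MochizukiCombGC2007, Thm 1.6(i) p.13].  PROOF-ONLY companion of
`PSCCoveringMapAlong.lean` (abc-iut-L3-t4, p422125: the image datum `G.mapAlong f hf S hS hne hQ`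
along a continuous surjection `f : Π_G ↠ Q`, e.g. a presentation of the maximal pro-`l` quotient),
in the pattern of abc-iut-w5-d188's `PSCCompactificationTransfer.lean` for `compactifyAlong`
(whose plumbing lemmas `map_inf_eq_of_ker_le`, `map_topologicalClosure_eq_of_isClosedMap`,
`map_map_eq_of_over` are consumed by name).  For presentations `f`, `f'` and an isomorphism
`β : Q ≅ Q'` LYING OVER `α : Π_G ≅ Π_H` (`β ∘ f = f' ∘ α`; it exists as soon as `α(ker f) = ker f'`,
`exists_over_of_ker_map_eq`, which for maximal pro-`S` presentations is `IsMaxProSigmaQuotient.map_ker_eq`):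

* classes: `IsGroupTheoreticallyVerticial.mapAlong`, `IsGroupTheoreticallyCuspidal.mapAlong`,
  `IsGroupTheoreticallyEdgeLike.mapAlong`, `IsGraphic.mapAlong` (the image data have the images of the
  verticial / cuspidal / edge-like subgroups as theirs: `is…_mapAlong_iff`);
* filtrations (Def. 1.1 (ii) / 1.4 (iii)): for `ker f ≤ U`, `mapAlong_vertFil_map`,
  `mapAlong_edgeFil_map`, `mapAlong_cuspFil_map` — `M^vert/edge/cusp` of the covering of the image
  datum attached to `f(U)` is the image of that of `G_U` — hence
  `IsVerticiallyFiltrationPreserving.mapAlong`, `IsEdgewiseFiltrationPreserving.mapAlong`,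
  `IsGraphicallyFiltrationPreserving.mapAlong` whenever `α(ker f) = ker f'`.
(Numerical cuspidality along `f` is row T16-L04 (b), abc-iut-w5-d183, one line over
`mapAlong_cuspCount`.)  The DESCENT from `β` to `α` is not formal and not claimed.  Pure proofs; no
definitions; no statement takes a side on [IUTchIII] Cor. 3.12.
-/

noncomputable section

namespace Literature.AnabelianGeometry.SemiGraphs

namespace PSCDatum

open scoped Pointwise

universe u

variable {P : Type u} [Group P] [TopologicalSpace P]
variable {P' : Type u} [Group P'] [TopologicalSpace P']
variable {Q : Type u} [Group Q] [TopologicalSpace Q]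
variable {Q' : Type u} [Group Q'] [TopologicalSpace Q']

section Transfer

variable [CompactSpace P] [CompactSpace P'] [T2Space Q] [T2Space Q']
variable (G : PSCDatum P) (H : PSCDatum P') {α : P ≃ₜ* P'}
variable (f : P →* Q) (hf : Continuous f)
  (S : Set ℕ) (hS : S ⊆ G.Sigma) (hne : S.Nonempty) (hQ : IsProSigma S Q)
variable (f' : P' →* Q') (hf' : Continuous f')
  (hS' : S ⊆ H.Sigma) (hQ' : IsProSigma S Q')
variable {β : Q ≃ₜ* Q'}

/-! #### Classes of subgroups -/

/-- **`α` group-theoretically verticial ⇒ `β` group-theoretically verticial** for the image data.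
[cite: MochizukiCombGC2007, Def 1.4(iv) p.11] -/
theorem IsGroupTheoreticallyVerticial.mapAlong (hs : Function.Surjective f) (hs' : Function.Surjective f') (h : G.IsGroupTheoreticallyVerticial H α)
    (hβ : ∀ x : P, β (f x) = f' (α x)) :
    (G.mapAlong f hf S hS hne hQ).IsGroupTheoreticallyVerticial (H.mapAlong f' hf' S hS' hne hQ') β := by
  constructor
  · intro A hA
    obtain ⟨B, hB, rfl⟩ := (G.isVerticial_mapAlong_iff f hf S hS hne hQ hs A).mp hA
    rw [map_map_eq_of_over hβ]
    exact (H.isVerticial_mapAlong_iff f' hf' S hS' hne hQ' hs' _).mpr ⟨_, h.1 B hB, rfl⟩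
  · intro B' hB'
    obtain ⟨B, hB, rfl⟩ := (H.isVerticial_mapAlong_iff f' hf' S hS' hne hQ' hs' B').mp hB'
    obtain ⟨A, hA, rfl⟩ := h.2 B hB
    exact ⟨A.map f, (G.isVerticial_mapAlong_iff f hf S hS hne hQ hs _).mpr ⟨A, hA, rfl⟩,
      map_map_eq_of_over hβ A⟩

/-- **`α` group-theoretically cuspidal ⇒ `β` group-theoretically cuspidal** for the image data
(cusps are KEPT by `mapAlong`). [cite: MochizukiCombGC2007, Def 1.4(iv) p.11] -/
theorem IsGroupTheoreticallyCuspidal.mapAlong (hs : Function.Surjective f) (hs' : Function.Surjective f') (h : G.IsGroupTheoreticallyCuspidal H α)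
    (hβ : ∀ x : P, β (f x) = f' (α x)) :
    (G.mapAlong f hf S hS hne hQ).IsGroupTheoreticallyCuspidal (H.mapAlong f' hf' S hS' hne hQ') β := by
  constructor
  · intro A hA
    obtain ⟨B, hB, rfl⟩ := (G.isCuspidal_mapAlong_iff f hf S hS hne hQ hs A).mp hA
    rw [map_map_eq_of_over hβ]
    exact (H.isCuspidal_mapAlong_iff f' hf' S hS' hne hQ' hs' _).mpr ⟨_, h.1 B hB, rfl⟩
  · intro B' hB'
    obtain ⟨B, hB, rfl⟩ := (H.isCuspidal_mapAlong_iff f' hf' S hS' hne hQ' hs' B').mp hB'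
    obtain ⟨A, hA, rfl⟩ := h.2 B hB
    exact ⟨A.map f, (G.isCuspidal_mapAlong_iff f hf S hS hne hQ hs _).mpr ⟨A, hA, rfl⟩,
      map_map_eq_of_over hβ A⟩

/-- **`α` group-theoretically edge-like ⇒ `β` group-theoretically edge-like** for the image data.
[cite: MochizukiCombGC2007, Def 1.4(iv) p.11] -/
theorem IsGroupTheoreticallyEdgeLike.mapAlong (hs : Function.Surjective f) (hs' : Function.Surjective f') (h : G.IsGroupTheoreticallyEdgeLike H α)
    (hβ : ∀ x : P, β (f x) = f' (α x)) :
    (G.mapAlong f hf S hS hne hQ).IsGroupTheoreticallyEdgeLike (H.mapAlong f' hf' S hS' hne hQ') β := by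
  constructor
  · intro A hA
    obtain ⟨B, hB, rfl⟩ := (G.isEdgeLike_mapAlong_iff f hf S hS hne hQ hs A).mp hA
    rw [map_map_eq_of_over hβ]
    exact (H.isEdgeLike_mapAlong_iff f' hf' S hS' hne hQ' hs' _).mpr ⟨_, h.1 B hB, rfl⟩
  · intro B' hB'
    obtain ⟨B, hB, rfl⟩ := (H.isEdgeLike_mapAlong_iff f' hf' S hS' hne hQ' hs' B').mp hB'
    obtain ⟨A, hA, rfl⟩ := h.2 B hB
    exact ⟨A.map f, (G.isEdgeLike_mapAlong_iff f hf S hS hne hQ hs _).mpr ⟨A, hA, rfl⟩,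
      map_map_eq_of_over hβ A⟩

/-- **`α` graphic ⇒ `β` graphic** for the image data (same underlying isomorphism of semi-graphs;
the converse descent is not formal and not claimed). [cite: MochizukiCombGC2007, Def 1.4(i) p.10] -/
theorem IsGraphic.mapAlong (h : G.IsGraphic H α) (hβ : ∀ x : P, β (f x) = f' (α x)) :
    (G.mapAlong f hf S hS hne hQ).IsGraphic (H.mapAlong f' hf' S hS' hne hQ') β := by
  obtain ⟨ι, hv, hn, hc⟩ := h
  refine ⟨ι, ?_, ?_, ?_⟩
  · intro v
    obtain ⟨γ, hγ⟩ := hv v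
    refine ⟨ConjAct.toConjAct (f' (ConjAct.ofConjAct γ)), ?_⟩
    change ((G.vertGp v).map f).map β.toMulEquiv.toMonoidHom = _ • (H.vertGp (ι.vertEquiv v)).map f'
    rw [map_map_eq_of_over hβ, hγ, map_conj_smul]
  · intro e
    obtain ⟨γ, hγ⟩ := hn e
    refine ⟨ConjAct.toConjAct (f' (ConjAct.ofConjAct γ)), ?_⟩
    change ((G.nodeGp e).map f).map β.toMulEquiv.toMonoidHom = _ • (H.nodeGp (ι.nodeEquiv e)).map f'
    rw [map_map_eq_of_over hβ, hγ, map_conj_smul]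
  · intro c
    obtain ⟨γ, hγ⟩ := hc c
    refine ⟨ConjAct.toConjAct (f' (ConjAct.ofConjAct γ)), ?_⟩
    change ((G.cuspGp c).map f).map β.toMulEquiv.toMonoidHom = _ • (H.cuspGp (ι.cuspEquiv c)).map f'
    rw [map_map_eq_of_over hβ, hγ, map_conj_smul]

/-! #### The filtration of the coverings of the image datum -/

variable [IsTopologicalGroup P] [IsTopologicalGroup P'] [IsTopologicalGroup Q] [IsTopologicalGroup Q']

omit [CompactSpace P'] [T2Space Q'] [IsTopologicalGroup P'] [IsTopologicalGroup Q'] in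
/-- **`M^vert` along `f`**: for `ker f ≤ U`, `M^vert` of the covering of the image datum attached to
`f(U)` is the image of `M^vert` of `G_U`. [cite: MochizukiCombGC2007, Def 1.1(ii) p.7] -/
theorem mapAlong_vertFil_map (hs : Function.Surjective f) {U : Subgroup P} (hU : f.ker ≤ U) :
    (G.mapAlong f hf S hS hne hQ).vertFil (U.map f) = (G.vertFil U).map f := by
  simp only [vertFil]
  rw [map_topologicalClosure_eq_of_isClosedMap f hf hf.isClosedMap, Subgroup.map_sup,
    Subgroup.map_commutator, Subgroup.map_iSup]
  congr 2
  apply le_antisymm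
  · refine iSup_le fun A' => ?_
    obtain ⟨A', B', hB', rfl⟩ := A'
    obtain ⟨B, hB, rfl⟩ := (G.isVerticial_mapAlong_iff f hf S hS hne hQ hs B').mp hB'
    exact le_iSup_of_le ⟨U ⊓ B, B, hB, rfl⟩ (le_of_eq (map_inf_eq_of_ker_le f hU B).symm)
  · refine iSup_le fun A => ?_
    obtain ⟨A, B, hB, rfl⟩ := A
    exact le_iSup_of_le ⟨U.map f ⊓ B.map f, B.map f,
      (G.isVerticial_mapAlong_iff f hf S hS hne hQ hs _).mpr ⟨B, hB, rfl⟩, rfl⟩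
      (le_of_eq (map_inf_eq_of_ker_le f hU B))

omit [CompactSpace P'] [T2Space Q'] [IsTopologicalGroup P'] [IsTopologicalGroup Q'] in
/-- **`M^edge` along `f`** (`ker f ≤ U`). [cite: MochizukiCombGC2007, Def 1.1(ii) p.7] -/
theorem mapAlong_edgeFil_map (hs : Function.Surjective f) {U : Subgroup P} (hU : f.ker ≤ U) :
    (G.mapAlong f hf S hS hne hQ).edgeFil (U.map f) = (G.edgeFil U).map f := by
  simp only [edgeFil]
  rw [map_topologicalClosure_eq_of_isClosedMap f hf hf.isClosedMap, Subgroup.map_sup,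
    Subgroup.map_commutator, Subgroup.map_iSup]
  congr 2
  apply le_antisymm
  · refine iSup_le fun A' => ?_
    obtain ⟨A', B', hB', rfl⟩ := A'
    obtain ⟨B, hB, rfl⟩ := (G.isEdgeLike_mapAlong_iff f hf S hS hne hQ hs B').mp hB'
    exact le_iSup_of_le ⟨U ⊓ B, B, hB, rfl⟩ (le_of_eq (map_inf_eq_of_ker_le f hU B).symm)
  · refine iSup_le fun A => ?_
    obtain ⟨A, B, hB, rfl⟩ := A
    exact le_iSup_of_le ⟨U.map f ⊓ B.map f, B.map f,
      (G.isEdgeLike_mapAlong_iff f hf S hS hne hQ hs _).mpr ⟨B, hB, rfl⟩, rfl⟩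
      (le_of_eq (map_inf_eq_of_ker_le f hU B))

omit [CompactSpace P'] [T2Space Q'] [IsTopologicalGroup P'] [IsTopologicalGroup Q'] in
/-- **`M^cusp` along `f`** (`ker f ≤ U`; cusps are kept by `mapAlong`).
[cite: MochizukiCombGC2007, Def 1.1(ii) p.7] -/
theorem mapAlong_cuspFil_map (hs : Function.Surjective f) {U : Subgroup P} (hU : f.ker ≤ U) :
    (G.mapAlong f hf S hS hne hQ).cuspFil (U.map f) = (G.cuspFil U).map f := by
  simp only [cuspFil]
  rw [map_topologicalClosure_eq_of_isClosedMap f hf hf.isClosedMap, Subgroup.map_sup,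
    Subgroup.map_commutator, Subgroup.map_iSup]
  congr 2
  apply le_antisymm
  · refine iSup_le fun A' => ?_
    obtain ⟨A', B', hB', rfl⟩ := A'
    obtain ⟨B, hB, rfl⟩ := (G.isCuspidal_mapAlong_iff f hf S hS hne hQ hs B').mp hB'
    exact le_iSup_of_le ⟨U ⊓ B, B, hB, rfl⟩ (le_of_eq (map_inf_eq_of_ker_le f hU B).symm)
  · refine iSup_le fun A => ?_
    obtain ⟨A, B, hB, rfl⟩ := A
    exact le_iSup_of_le ⟨U.map f ⊓ B.map f, B.map f,
      (G.isCuspidal_mapAlong_iff f hf S hS hne hQ hs _).mpr ⟨B, hB, rfl⟩, rfl⟩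
      (le_of_eq (map_inf_eq_of_ker_le f hU B))

/-! #### Filtration-preservation survives the passage to the image data -/

/-- **`α` verticially filtration-preserving ⇒ `β` verticially filtration-preserving** for the image
data, whenever `α(ker f) = ker f'` (the coverings of `Q` pull back to the coverings of `Π_G` containing
`ker f`, which correspond under `α` to those of `Π_H` containing `ker f'`).
[cite: MochizukiCombGC2007, Def 1.4(iii) p.10] -/
theorem IsVerticiallyFiltrationPreserving.mapAlong (hs : Function.Surjective f) (hs' : Function.Surjective f') (h : G.IsVerticiallyFiltrationPreserving H α)
    (hker : f.ker.map α.toMulEquiv.toMonoidHom = f'.ker) (hβ : ∀ x : P, β (f x) = f' (α x)) :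
    (G.mapAlong f hf S hS hne hQ).IsVerticiallyFiltrationPreserving (H.mapAlong f' hf' S hS' hne hQ') β := by
  intro Ubar hUbar
  have hUopen : IsOpen ((Ubar.comap f : Subgroup P) : Set P) := hUbar.preimage hf
  have hkU : f.ker ≤ Ubar.comap f := MonoidHom.ker_le_comap f Ubar
  have hkU' : f'.ker ≤ (Ubar.comap f).map α.toMulEquiv.toMonoidHom := by
    rw [← hker]; exact Subgroup.map_mono hkU
  have hUf : (Ubar.comap f).map f = Ubar := Subgroup.map_comap_eq_self_of_surjective hs Ubar
  calc ((G.mapAlong f hf S hS hne hQ).vertFil Ubar).map β.toMulEquiv.toMonoidHom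
      = ((G.vertFil (Ubar.comap f)).map f).map β.toMulEquiv.toMonoidHom := by
          rw [← G.mapAlong_vertFil_map f hf S hS hne hQ hs hkU, hUf]
    _ = ((G.vertFil (Ubar.comap f)).map α.toMulEquiv.toMonoidHom).map f' := map_map_eq_of_over hβ _
    _ = (H.vertFil ((Ubar.comap f).map α.toMulEquiv.toMonoidHom)).map f' := by rw [h _ hUopen]
    _ = (H.mapAlong f' hf' S hS' hne hQ').vertFil
          (((Ubar.comap f).map α.toMulEquiv.toMonoidHom).map f') :=
          (H.mapAlong_vertFil_map f' hf' S hS' hne hQ' hs' hkU').symm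
    _ = (H.mapAlong f' hf' S hS' hne hQ').vertFil (((Ubar.comap f).map f).map β.toMulEquiv.toMonoidHom) := by
          rw [map_map_eq_of_over hβ]
    _ = (H.mapAlong f' hf' S hS' hne hQ').vertFil (Ubar.map β.toMulEquiv.toMonoidHom) := by rw [hUf]

/-- **`α` edgewise filtration-preserving ⇒ `β` edgewise filtration-preserving** for the image data,
whenever `α(ker f) = ker f'`. [cite: MochizukiCombGC2007, Def 1.4(iii) p.10] -/
theorem IsEdgewiseFiltrationPreserving.mapAlong (hs : Function.Surjective f) (hs' : Function.Surjective f') (h : G.IsEdgewiseFiltrationPreserving H α)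
    (hker : f.ker.map α.toMulEquiv.toMonoidHom = f'.ker) (hβ : ∀ x : P, β (f x) = f' (α x)) :
    (G.mapAlong f hf S hS hne hQ).IsEdgewiseFiltrationPreserving (H.mapAlong f' hf' S hS' hne hQ') β := by
  intro Ubar hUbar
  have hUopen : IsOpen ((Ubar.comap f : Subgroup P) : Set P) := hUbar.preimage hf
  have hkU : f.ker ≤ Ubar.comap f := MonoidHom.ker_le_comap f Ubar
  have hkU' : f'.ker ≤ (Ubar.comap f).map α.toMulEquiv.toMonoidHom := by
    rw [← hker]; exact Subgroup.map_mono hkU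
  have hUf : (Ubar.comap f).map f = Ubar := Subgroup.map_comap_eq_self_of_surjective hs Ubar
  calc ((G.mapAlong f hf S hS hne hQ).edgeFil Ubar).map β.toMulEquiv.toMonoidHom
      = ((G.edgeFil (Ubar.comap f)).map f).map β.toMulEquiv.toMonoidHom := by
          rw [← G.mapAlong_edgeFil_map f hf S hS hne hQ hs hkU, hUf]
    _ = ((G.edgeFil (Ubar.comap f)).map α.toMulEquiv.toMonoidHom).map f' := map_map_eq_of_over hβ _
    _ = (H.edgeFil ((Ubar.comap f).map α.toMulEquiv.toMonoidHom)).map f' := by rw [h _ hUopen]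
    _ = (H.mapAlong f' hf' S hS' hne hQ').edgeFil
          (((Ubar.comap f).map α.toMulEquiv.toMonoidHom).map f') :=
          (H.mapAlong_edgeFil_map f' hf' S hS' hne hQ' hs' hkU').symm
    _ = (H.mapAlong f' hf' S hS' hne hQ').edgeFil (((Ubar.comap f).map f).map β.toMulEquiv.toMonoidHom) := by
          rw [map_map_eq_of_over hβ]
    _ = (H.mapAlong f' hf' S hS' hne hQ').edgeFil (Ubar.map β.toMulEquiv.toMonoidHom) := by rw [hUf]

/-- **`α` graphically filtration-preserving ⇒ `β` graphically filtration-preserving** for the image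
data, whenever `α(ker f) = ker f'` — the hypothesis of Thm. 1.6 (ii) survives "we may assume
`Σ = {l}`". [cite: MochizukiCombGC2007, Def 1.4(iii) p.10] -/
theorem IsGraphicallyFiltrationPreserving.mapAlong (hs : Function.Surjective f) (hs' : Function.Surjective f') (h : G.IsGraphicallyFiltrationPreserving H α)
    (hker : f.ker.map α.toMulEquiv.toMonoidHom = f'.ker) (hβ : ∀ x : P, β (f x) = f' (α x)) :
    (G.mapAlong f hf S hS hne hQ).IsGraphicallyFiltrationPreserving (H.mapAlong f' hf' S hS' hne hQ')
      β :=
  ⟨h.1.mapAlong G H f hf S hS hne hQ f' hf' hS' hQ' hs hs' hker hβ,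
    h.2.mapAlong G H f hf S hS hne hQ f' hf' hS' hQ' hs hs' hker hβ⟩

end Transfer

end PSCDatum

end Literature.AnabelianGeometry.SemiGraphs
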